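import Literature.AlgebraicGeometry.Resolution.SemiStableFibreDimension
import Literature.AlgebraicGeometry.Resolution.RelativeDimensionCurve
import Literature.AlgebraicGeometry.Resolution.FormalNormalCrossingsLemmas
import Literature.AlgebraicGeometry.Motives.CyclesEquivalencesProofs
import Mathlib.AlgebraicGeometry.Morphisms.Integral
import Mathlib.RingTheory.MvPowerSeries.NoZeroDivisors
import HarnessLib

/-!
# A semi-stable curve has relative dimension one: `dim X = dim S + 1`

Topic: `Literature/AlgebraicGeometry/Resolution`. Dimension theory of semi-stable curves
`f : X → S` (de Jong 1996, 2.21, `IsSemiStableCurve`: flat, proper, of finite presentation, the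
geometric fibres connected with closed points whose local rings are regular of dimension `1` or
ordinary double points). Everything here is PROVED:

* `IsOrdinaryDoublePoint.ringKrullDim_eq_one` — **the local ring of an ordinary double point has
  dimension `1`**: `dim 𝒪 = dim 𝒪̂ = dim K⟦u, v⟧/(uv)`, and `dim K⟦u, v⟧/(uv) ≤ 1`
  (`ringKrullDim_quotient_span_X_mul_X_le_one`: `dim K⟦u, v⟧ ≤ 2`, the maximal ideal being
  `(u, v)`, and `uv` is a non-zero-divisor in it, Krull), while `≥ 1` is
  `IsOrdinaryDoublePoint.one_le_ringKrullDim` (`SemiStableFibreDimension.lean`);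
* `IsSemiStableCurve.topologicalKrullDim_pullback_eq_one` — **a geometric fibre
  `X ×_S Spec K` has dimension `1`** (every point of the quasi-compact fibre specialises to a
  closed point, of codimension `dim 𝒪 = 1`);
  `IsSemiStableCurve.topologicalKrullDim_pullback_eq_one_of_field`,
  `IsSemiStableCurve.topologicalKrullDim_fiber_eq_one` — **so has every fibre `X ×_S Spec κ` over
  any field**, in particular every `X_y = f.fiber y`: the projection `X_κ ⊗_κ κ̄ → X_κ` is integral
  and surjective, and such morphisms preserve dimension
  (`topologicalKrullDim_eq_of_isIntegralHom_of_surjective`, Stacks 0ECG: going up and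
  incomparability);
* `IsSemiStableCurve.topologicalKrullDim_eq` — **`dim X = dim S + 1` for every semi-stable curve
  over a locally Noetherian base** (Görtz–Wedhorn I, Prop. 14.109 (2), "`dim X = dim Y +
  dim f⁻¹(η)`", for semi-stable curves, with neither irreducibility nor catenarity hypotheses):
  `dim S + 1 ≤ dim X` (`topologicalKrullDim_base_add_one_le`, any base) since every fibre contains
  a proper specialisation `x₁ ⤳ x₀`, chains of `S` lift along the flat — generalizing — `f` from
  `x₁` upwards and `x₀` is one more link (`krullDim_add_one_le_of_cofibration`); and
  `dim X ≤ dim S + 1` (`topologicalKrullDim_le_base_add_one`) by the dimension formula at a point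
  of a FLAT morphism of locally Noetherian schemes, EGA IV₂ (6.1.2) — proved in this tree as
  `Literature.AlgebraicGeometry.Motives.coheight_eq_coheight_add_ringKrullDim_stalk_fiber`:
  `codim x = codim f(x) + dim 𝒪_{X_{f x}, x}` — together with `dim = sup codim` (Mathlib
  `Order.krullDim_eq_iSup_coheight`, `ringKrullDim_stalk_eq_coheight`) and `dim X_{f x} = 1`.
  (The printed proof of Prop. 14.109 (2) uses instead the dimension formula Thm. 14.106 —
  Matsumura 15.5/15.6 — and universal catenarity, Prop. 14.104, which Mathlib lacks; flatness
  replaces them.)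

This serves the discharge of the named fact `SemiStableCurveRelativeDimensionOne`
(`AlterationsPreSemiStableToSemiStable.lean`; discharged in
`AlterationsPreSemiStableToSemiStableProofs.lean`).

## Sources

* A. J. de Jong, *Smoothness, semi-stability and alterations*, Publ. Math. IHÉS 83 (1996),
  2.21–2.23 (p. 61), 4.22 (pp. 74–75).
* U. Görtz, T. Wedhorn, *Algebraic Geometry I: Schemes*, 2nd ed. (2020), Prop. 14.109 (2) with
  Lemma 14.108 and (14.26.2) (PDF pp. 596–598 of the held copy); Prop. 14.104.
* A. Grothendieck, J. Dieudonné, EGA IV₂ (1965), Cor. (6.1.2) (dimension formula, flat case).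
* The Stacks Project, Tag 0ECG (integral surjective morphisms preserve dimension).
-/

noncomputable section

open CategoryTheory CategoryTheory.Limits AlgebraicGeometry TopologicalSpace Topology Order

namespace Literature.AlgebraicGeometry.Resolution

universe u

/-! ## The local ring of an ordinary double point has dimension one -/

namespace IsOrdinaryDoublePoint

variable (K : Type u) [Field K]

/-- **`dim K⟦u, v⟧/(uv) ≤ 1`.** The power series ring `K⟦u, v⟧` is a Noetherian local domain
whose maximal ideal is generated by the two variables, so `dim K⟦u, v⟧ ≤ 2` (Krull); `uv` is a
non-zero-divisor in the maximal ideal, so `dim K⟦u, v⟧/(uv) + 1 = dim K⟦u, v⟧`. [folklore] -/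
theorem ringKrullDim_quotient_span_X_mul_X_le_one :
    ringKrullDim (MvPowerSeries (Fin 2) K ⧸
      Ideal.span {(MvPowerSeries.X 0 * MvPowerSeries.X 1 : MvPowerSeries (Fin 2) K)}) ≤ 1 := by
  haveI : IsNoetherianRing (MvPowerSeries (Fin 2) K) := isNoetherianRing_mvPowerSeries K (Fin 2)
  haveI : IsDomain (MvPowerSeries (Fin 2) K) := NoZeroDivisors.to_isDomain _
  have hm := maximalIdeal_mvPowerSeries_eq_span_range_X (σ := Fin 2) K
  -- `dim K⟦u, v⟧ ≤ 2`
  have h2 : ringKrullDim (MvPowerSeries (Fin 2) K) ≤ ((1 + 1 : ℕ) : WithBot ℕ∞) := by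
    refine (ringKrullDim_le_spanFinrank_maximalIdeal _).trans ?_
    have hsub : Set.range (MvPowerSeries.X : Fin 2 → MvPowerSeries (Fin 2) K) ⊆
        {MvPowerSeries.X 0, MvPowerSeries.X 1} := by
      rintro _ ⟨i, rfl⟩
      fin_cases i <;> simp
    have hcard : (Set.range (MvPowerSeries.X : Fin 2 → MvPowerSeries (Fin 2) K)).encard ≤ 2 :=
      (Set.encard_le_encard hsub).trans
        ((Set.encard_insert_le _ _).trans (by rw [Set.encard_singleton]; rfl))
    have h := (Submodule.spanFinrank_span_le_encard (R := MvPowerSeries (Fin 2) K)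
      (Set.range (MvPowerSeries.X : Fin 2 → MvPowerSeries (Fin 2) K))).trans hcard
    rw [hm]
    exact_mod_cast h
  -- `uv` is a non-zero-divisor in the maximal ideal
  have hX : ∀ s : Fin 2, (MvPowerSeries.X s : MvPowerSeries (Fin 2) K) ≠ 0 := fun s h => by
    have := congrArg (MvPowerSeries.coeff (Finsupp.single s 1)) h
    rw [MvPowerSeries.coeff_index_single_self_X, map_zero] at this
    exact one_ne_zero this
  have hreg : (MvPowerSeries.X 0 * MvPowerSeries.X 1 : MvPowerSeries (Fin 2) K) ∈
      nonZeroDivisors (MvPowerSeries (Fin 2) K) :=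
    mem_nonZeroDivisors_of_ne_zero (mul_ne_zero (hX 0) (hX 1))
  have hmem : (MvPowerSeries.X 0 * MvPowerSeries.X 1 : MvPowerSeries (Fin 2) K) ∈
      IsLocalRing.maximalIdeal (MvPowerSeries (Fin 2) K) := by
    rw [hm]
    exact Ideal.mul_mem_left _ _ (Ideal.subset_span ⟨1, rfl⟩)
  have hN := ringKrullDim_quotient_span_singleton_succ_eq_ringKrullDim_of_mem_nonZeroDivisors
    hreg hmem
  rw [← hN] at h2
  exact WithBotENat.le_natCast_of_add_one_le h2

variable {K}

/-- **The local ring of an ordinary double point has dimension `≤ 1`**: for a Noetherian local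
ring `𝒪` with `𝒪̂ ≅ K⟦u, v⟧/(uv)`, `dim 𝒪 = dim 𝒪̂ = dim K⟦u, v⟧/(uv) ≤ 1`. [folklore] -/
theorem ringKrullDim_le_one {C : Scheme.{u}} {x : C} [IsNoetherianRing (C.presheaf.stalk x)]
    (h : IsOrdinaryDoublePoint K x) : ringKrullDim (C.presheaf.stalk x) ≤ 1 := by
  obtain ⟨e⟩ := h
  rw [← ringKrullDim_adicCompletion (C.presheaf.stalk x : Type u), ringKrullDim_eq_of_ringEquiv e]
  exact ringKrullDim_quotient_span_X_mul_X_le_one K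

/-- **The local ring of an ordinary double point has dimension `1`** (de Jong 1996, 2.23: it is a
singular point of a curve). [cite: DeJong1996, 2.23, pp. 61–62] -/
theorem ringKrullDim_eq_one {C : Scheme.{u}} {x : C} [IsNoetherianRing (C.presheaf.stalk x)]
    (h : IsOrdinaryDoublePoint K x) : ringKrullDim (C.presheaf.stalk x) = 1 :=
  le_antisymm h.ringKrullDim_le_one (h.one_le_ringKrullDim K)

end IsOrdinaryDoublePoint

/-! ## Integral surjective morphisms preserve dimension -/

/-- **An integral surjective morphism of schemes preserves dimension** (Stacks 0ECG): going up
(`p` is universally closed, `Literature.AlgebraicGeometry.Motives.Scheme.topologicalKrullDim_le_of_universallyClosed_of_surjective`)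
and incomparability (`eq_of_specializes_of_isIntegralHom`).
[cite: StacksProject, Tag 0ECG (Lemma 29.45.9)] -/
theorem topologicalKrullDim_eq_of_isIntegralHom_of_surjective {X Y : Scheme.{u}} (p : X ⟶ Y)
    [IsIntegralHom p] [Surjective p] : topologicalKrullDim X = topologicalKrullDim Y :=
  le_antisymm
    (Literature.AlgebraicGeometry.Motives.topologicalKrullDim_le_of_specializes_imp_eq p.continuous
      fun _ _ hab hpab => eq_of_specializes_of_isIntegralHom p hab hpab)
    (Literature.AlgebraicGeometry.Motives.Scheme.topologicalKrullDim_le_of_universallyClosed_of_surjective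
      p)

/-! ## The fibres of a semi-stable curve have dimension one -/

namespace IsSemiStableCurve

variable {X S : Scheme.{u}} {f : X ⟶ S}

/-- The local ring of a geometric fibre of a semi-stable curve at a closed point has dimension
`1`: it is regular of dimension `1` or an ordinary double point (de Jong 1996, 2.21).
[cite: DeJong1996, 2.21, p. 61] -/
theorem ringKrullDim_stalk_pullback_eq_one (h : IsSemiStableCurve f) (K : Type u) [Field K]
    [IsAlgClosed K] (s : Spec (.of K) ⟶ S) (x : ↥(pullback f s))
    (hx : IsClosed ({x} : Set ↥(pullback f s))) :
    ringKrullDim ((pullback f s).presheaf.stalk x) = 1 := by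
  haveI := h.locallyOfFinitePresentation
  haveI : IsLocallyNoetherian (pullback f s) :=
    LocallyOfFiniteType.isLocallyNoetherian (pullback.snd f s)
  rcases h.isRegularLocalRing_or_isOrdinaryDoublePoint K s x hx with ⟨-, h1⟩ | hnode
  · exact h1
  · exact hnode.ringKrullDim_eq_one

/-- **A geometric fibre of a semi-stable curve has dimension `1`** (de Jong 1996, 2.21: "all
geometric fibres are connected curves"): `X_s̄ = X ×_S Spec K` is non-empty and quasi-compact, so
every point specialises to a closed point, and the closed points have codimension
`dim 𝒪_{X_s̄, x} = 1` (`ringKrullDim_stalk_pullback_eq_one`). [cite: DeJong1996, 2.21, p. 61] -/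
theorem topologicalKrullDim_pullback_eq_one (h : IsSemiStableCurve f) (K : Type u) [Field K]
    [IsAlgClosed K] (s : Spec (.of K) ⟶ S) : topologicalKrullDim ↥(pullback f s) = 1 := by
  haveI := h.isProper
  haveI : CompactSpace ↥(pullback f s) :=
    QuasiCompact.compactSpace_of_compactSpace (pullback.snd f s)
  haveI : ConnectedSpace ↥(pullback f s) := h.connectedSpace_pullback K s
  rw [topologicalKrullDim_eq_krullDim_carrier, krullDim_eq_iSup_coheight]
  -- closed points have codimension `1`, and every point specialises to a closed point
  have hcl : ∀ c : ↥(pullback f s), IsClosed ({c} : Set ↥(pullback f s)) → coheight c = 1 := by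
    intro c hc
    have := h.ringKrullDim_stalk_pullback_eq_one K s c hc
    rw [ringKrullDim_stalk_eq_coheight] at this
    exact_mod_cast this
  have hsp : ∀ x : ↥(pullback f s), ∃ c : ↥(pullback f s),
      IsClosed ({c} : Set ↥(pullback f s)) ∧ x ⤳ c := fun x => by
    obtain ⟨c, hc_mem, hc⟩ := (isClosed_closure (s := ({x} : Set ↥(pullback f s))))
      |>.exists_closed_singleton ⟨x, subset_closure rfl⟩
    exact ⟨c, hc, specializes_iff_mem_closure.mpr hc_mem⟩
  apply le_antisymm
  · refine iSup_le fun x => ?_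
    obtain ⟨c, hc, hxc⟩ := hsp x
    have hle : coheight x ≤ coheight c := coheight_anti (Scheme.le_iff_specializes.mpr hxc)
    rw [hcl c hc] at hle
    exact_mod_cast hle
  · obtain ⟨c, hc, -⟩ := hsp (Classical.arbitrary _)
    refine le_trans (le_of_eq ?_) (le_iSup (fun a : ↥(pullback f s) => (coheight a : WithBot ℕ∞)) c)
    rw [hcl c hc]
    rfl

/-- **Every fibre of a semi-stable curve over a field-valued point has dimension `1`**: for
`s : Spec κ → S`, `κ` any field, the projection `X_s ⊗_κ κ̄ → X_s` from the geometric fibre over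
an algebraic closure is integral and surjective (a base change of `Spec κ̄ → Spec κ`), hence
preserves dimension (Stacks 0ECG), and `dim X_s ⊗_κ κ̄ = 1`
(`topologicalKrullDim_pullback_eq_one`). [cite: DeJong1996, 2.21, p. 61] -/
theorem topologicalKrullDim_pullback_eq_one_of_field (h : IsSemiStableCurve f) (κ : Type u)
    [Field κ] (s : Spec (.of κ) ⟶ S) : topologicalKrullDim ↥(pullback f s) = 1 := by
  let Kb : Type u := AlgebraicClosure κ
  let ι : Spec (.of Kb) ⟶ Spec (.of κ) := Spec.map (CommRingCat.ofHom (algebraMap κ Kb))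
  have h1 : topologicalKrullDim ↥(pullback f (ι ≫ s)) = 1 :=
    h.topologicalKrullDim_pullback_eq_one Kb (ι ≫ s)
  -- `X ×_S Spec κ̄ ≅ (X ×_S Spec κ) ×_{Spec κ} Spec κ̄ → X ×_S Spec κ` is integral and surjective
  have h2 : topologicalKrullDim ↥(pullback (pullback.snd f s) ι) = 1 := by
    rw [← h1]
    exact IsHomeomorph.topologicalKrullDim_eq _
      (Scheme.homeoOfIso (pullbackLeftPullbackSndIso f s ι)).isHomeomorph
  haveI : IsIntegralHom ι := by
    refine IsIntegralHom.SpecMap_iff.mpr ?_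
    change (algebraMap κ Kb).IsIntegral
    exact fun x => Algebra.IsIntegral.isIntegral x
  haveI : Surjective ι := by
    dsimp only [ι]
    infer_instance
  rw [← h2]
  exact (topologicalKrullDim_eq_of_isIntegralHom_of_surjective
    (pullback.fst (pullback.snd f s) ι)).symm

/-- **Every fibre `X_y = X ×_S Spec κ(y)` of a semi-stable curve has dimension `1`** — the
hypothesis "`dim f⁻¹(y) = 1` for all `y`" of Görtz–Wedhorn I, Prop. 14.109, for semi-stable
curves. [cite: DeJong1996, 2.21, p. 61] -/
theorem topologicalKrullDim_fiber_eq_one (h : IsSemiStableCurve f) (y : S) :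
    topologicalKrullDim ↥(f.fiber y) = 1 :=
  h.topologicalKrullDim_pullback_eq_one_of_field (S.residueField y) (S.fromSpecResidueField y)

/-- Every fibre of a semi-stable curve contains a proper specialisation `x₁ ⤳ x₀`, `x₁ ≠ x₀`
(it has dimension `1`). [cite: DeJong1996, 2.21, p. 61] -/
theorem exists_specializes_ne_of_mem (h : IsSemiStableCurve f) (y : S) :
    ∃ x₀ x₁ : X, f x₀ = y ∧ f x₁ = y ∧ x₁ ⤳ x₀ ∧ x₁ ≠ x₀ := by
  have h1 : 1 ≤ krullDim ↥(f.fiber y) := by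
    rw [← topologicalKrullDim_eq_krullDim_carrier, h.topologicalKrullDim_fiber_eq_one y]
  obtain ⟨z₀, z₁, hz⟩ := one_le_krullDim_iff.mp h1
  have hmem : ∀ z : ↥(f.fiber y), f (f.fiberι y z) = y := fun z => by
    have hz : f.fiberι y z ∈ f ⁻¹' {y} := f.range_fiberι y ▸ Set.mem_range_self z
    exact hz
  refine ⟨f.fiberι y z₀, f.fiberι y z₁, hmem z₀, hmem z₁, ?_, ?_⟩
  · exact (show z₁ ⤳ z₀ from Scheme.le_iff_specializes.mp hz.le).map (f.fiberι y).continuous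
  · intro heq
    exact hz.ne ((f.fiberι y).isEmbedding.injective heq).symm

/-- **`dim S + 1 ≤ dim X` for a semi-stable curve `f : X → S`** over any base: every fibre
contains a proper specialisation `x₁ ⤳ x₀` (`exists_specializes_ne_of_mem`), every chain of
specialisations of `S` lifts to `X` upwards from `x₁` (`f` is flat, hence generalizing), and `x₀`
is one more link. [folklore] -/
theorem topologicalKrullDim_base_add_one_le (h : IsSemiStableCurve f) :
    topologicalKrullDim S + 1 ≤ topologicalKrullDim X := by
  haveI := h.flat
  rw [topologicalKrullDim_eq_krullDim_carrier X, topologicalKrullDim_eq_krullDim_carrier S]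
  refine krullDim_add_one_le_of_cofibration (fun x : X => f x) ?_ ?_
  · -- generisations lift along the flat `f`
    intro a b hab
    obtain ⟨a', ha', hfa'⟩ := Flat.generalizingMap f (show b ⤳ f a from hab.le)
    refine ⟨a', lt_of_le_not_ge ha' fun hle => hab.not_ge ?_, hfa'⟩
    change f a ⤳ b
    rw [← hfa']
    exact (show a ⤳ a' from hle).map f.continuous
  · intro y
    obtain ⟨x₀, x₁, -, hx₁, hsp, hne⟩ := h.exists_specializes_ne_of_mem y
    exact ⟨x₀, x₁, lt_of_le_not_ge hsp fun h' => hne (hsp.antisymm h').eq, Or.inl hx₁⟩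

/-- **`dim X ≤ dim S + 1` for a semi-stable curve `f : X → S` over a locally Noetherian base**:
by the dimension formula for the flat `f` (EGA IV₂ (6.1.2),
`Literature.AlgebraicGeometry.Motives.coheight_eq_coheight_add_ringKrullDim_stalk_fiber`),
`codim x = codim f(x) + dim 𝒪_{X_{f x}, x} ≤ dim S + 1` for every `x ∈ X`, the fibres having
dimension `1` (`topologicalKrullDim_fiber_eq_one`).
[cite: GrothendieckDieudonne1965, Cor. (6.1.2), p. 135] -/
theorem topologicalKrullDim_le_base_add_one (h : IsSemiStableCurve f) [IsLocallyNoetherian S] :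
    topologicalKrullDim X ≤ topologicalKrullDim S + 1 := by
  haveI := h.flat
  haveI := h.locallyOfFinitePresentation
  haveI : IsLocallyNoetherian X := LocallyOfFiniteType.isLocallyNoetherian f
  have hfib : ∀ (y : S) (z : ↥(f.fiber y)), (coheight z : WithBot ℕ∞) ≤ 1 := fun y z => by
    have := coheight_le_krullDim z
    rwa [← topologicalKrullDim_eq_krullDim_carrier, h.topologicalKrullDim_fiber_eq_one y] at this
  rw [topologicalKrullDim_eq_krullDim_carrier X, topologicalKrullDim_eq_krullDim_carrier S,
    krullDim_eq_iSup_coheight (α := ↥X)]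
  refine iSup_le fun x => ?_
  have hx := Literature.AlgebraicGeometry.Motives.coheight_eq_coheight_add_ringKrullDim_stalk_fiber
    f x
  rw [ringKrullDim_stalk_eq_coheight] at hx
  rw [hx]
  exact add_le_add (coheight_le_krullDim (f x)) (hfib _ _)

/-- **A semi-stable curve has relative dimension one: `dim X = dim S + 1`** for every
semi-stable curve `f : X → S` (de Jong 1996, 2.21) over a locally Noetherian scheme `S`
(topological Krull dimensions, in `WithBot ℕ∞`; both sides are `⊥` for `S = ∅` and `⊤` for `S`
infinite-dimensional). This is Görtz–Wedhorn I, Prop. 14.109 (2) for semi-stable curves, without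
irreducibility or catenarity hypotheses (flatness replaces them).
[cite: GortzWedhorn2020, Prop. 14.109 (2)] -/
theorem topologicalKrullDim_eq (h : IsSemiStableCurve f) [IsLocallyNoetherian S] :
    topologicalKrullDim X = topologicalKrullDim S + 1 :=
  le_antisymm h.topologicalKrullDim_le_base_add_one h.topologicalKrullDim_base_add_one_le

end IsSemiStableCurve

end Literature.AlgebraicGeometry.Resolution

end
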